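import Mathlib

/-!
# SoloInformedLogMomentAbelian — identifying the `k`-th log-moment from the Dirichlet series by finite differences

Solo unit `solo-Parity-informed` (ideation tier, informed mode), session 17; `PLAN.md` §25.3 (α3), CLAIMS C80.

**An Abelian identification lemma (new device).**  Let `c : ℕ → ℝ`, `k ≥ 1`, and suppose
* the `k`-th log-moment converges: `∑_{n ≤ N} c(n) logᵏ n → A`;
* the Dirichlet series `D(u) = ∑_n c(n) n^{-u}` converges for `u > 0` and `D(u)/uᵏ → C` as `u → 0⁺`.
Then `A = (-1)ᵏ k! C` (`logPowSum_limit_eq_of_dirichletSeries`).  NO information on the lower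
log-moments is needed: the `k`-th finite difference `∑_{i=0}^{k} (-1)^{k-i} (k choose i) D((i+1)u)
= ∑_n c(n) n^{-u} (n^{-u} - 1)ᵏ = (-u)ᵏ ∑_n c(n) logᵏ n · Φ_k(u log n)` with the weight
`Φ_k(v) = e^{-v} ((1 - e^{-v})/v)ᵏ`, which is `≤ 1`, antitone, and `→ 1` as `v → 0⁺`; Abel summation with
such weights (`tendsto_of_antitone_weights`, the discrete Abel limit theorem for general monotone kernels)
gives `(-u)^{-k} Δᵏ D → A`, while `D(u) ~ C uᵏ` and `Δᵏ[x ↦ xᵏ] = k!` give `(-u)^{-k} Δᵏ D → (-1)ᵏ k! C`.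
Purely real-variable; used to identify `lim ∑_{e ≤ y} μ(e) ρ_F(e) logᵏ e / e = (-1)ᵏ k! · C(f)` for
Bateman–Horn systems from `tendsto_moebiusRootCountSys_mul_zetaReal_pow`.
-/

namespace Summit.Parity.BatemanHorn.Theorems

open Finset Filter Real
open scoped Topology Nat

/-! ### Abel summation with a general kernel -/

/-- Abel summation: `∑_{n ≤ N} c(n) ψ(n) - A = (S(N) - A) ψ(N) + ∑_{1 ≤ n < N} (S(n) - A)(ψ(n) - ψ(n+1))`
for `N ≥ 1`, where `S(N) = ∑_{n ≤ N} c(n)` and `ψ(1) = 1`. -/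
theorem sum_mul_kernel_sub_eq (c : ℕ → ℝ) {ψ : ℕ → ℝ} (hψ1 : ψ 1 = 1) (A : ℝ) {N : ℕ} (hN : 1 ≤ N) :
    ∑ n ∈ Icc 1 N, c n * ψ n - A
      = (∑ n ∈ Icc 1 N, c n - A) * ψ N
        + ∑ n ∈ Ico 1 N, (∑ m ∈ Icc 1 n, c m - A) * (ψ n - ψ (n + 1)) := by
  induction N, hN using Nat.le_induction with
  | base => simp [hψ1]
  | succ N hN ih =>
    rw [sum_Icc_succ_top (by omega), sum_Icc_succ_top (by omega), sum_Ico_succ_top hN,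
      show ∑ n ∈ Icc 1 N, c n * ψ n = (∑ n ∈ Icc 1 N, c n * ψ n - A) + A by ring, ih]
    ring

/-- Telescoping of the kernel differences over `[a, b)`. -/
theorem sum_Ico_kernel_sub (ψ : ℕ → ℝ) {a b : ℕ} (hab : a ≤ b) :
    ∑ n ∈ Ico a b, (ψ n - ψ (n + 1)) = ψ a - ψ b := by
  induction b, hab using Nat.le_induction with
  | base => simp
  | succ b hb ih => rw [sum_Ico_succ_top hb, ih]; ring

/-- An antitone kernel with `ψ(1) = 1` is `≤ 1` on `n ≥ 1`. -/
theorem kernel_le_one {ψ : ℕ → ℝ} (hψ1 : ψ 1 = 1) (hanti : ∀ n, 1 ≤ n → ψ (n + 1) ≤ ψ n) {n : ℕ}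
    (hn : 1 ≤ n) : ψ n ≤ 1 := by
  induction n, hn using Nat.le_induction with
  | base => exact hψ1.le
  | succ n hn ih => exact (hanti n hn).trans ih

/-- **The discrete Abel limit theorem for monotone kernels.**  If `∑_{n ≤ N} c(n) → A`, the kernels
`ψ_u` (`u > 0`) satisfy `ψ_u(1) = 1`, `0 ≤ ψ_u(n+1) ≤ ψ_u(n)` (`n ≥ 1`), `ψ_u(n) → 1` as `u → 0⁺` for each
fixed `n`, and `W(u) = lim_N ∑_{n ≤ N} c(n) ψ_u(n)` exists for `u > 0`, then `W(u) → A` as `u → 0⁺`. -/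
theorem tendsto_of_antitone_weights {c : ℕ → ℝ} {A : ℝ}
    (hA : Tendsto (fun N : ℕ => ∑ n ∈ Icc 1 N, c n) atTop (𝓝 A))
    {ψ : ℝ → ℕ → ℝ} (hψ1 : ∀ u, ψ u 1 = 1)
    (hanti : ∀ u, 0 < u → ∀ n, 1 ≤ n → ψ u (n + 1) ≤ ψ u n)
    (hpos : ∀ u, 0 < u → ∀ n, 1 ≤ n → 0 ≤ ψ u n)
    (hlim : ∀ n : ℕ, 1 ≤ n → Tendsto (fun u => ψ u n) (𝓝[>] 0) (𝓝 1))
    {W : ℝ → ℝ}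
    (hW : ∀ u, 0 < u → Tendsto (fun N : ℕ => ∑ n ∈ Icc 1 N, c n * ψ u n) atTop (𝓝 (W u))) :
    Tendsto W (𝓝[>] 0) (𝓝 A) := by
  set S : ℕ → ℝ := fun N => ∑ n ∈ Icc 1 N, c n with hS
  have he0 : Tendsto (fun N => S N - A) atTop (𝓝 0) := by
    have := hA.sub_const A
    rwa [sub_self] at this
  obtain ⟨E, hE⟩ := (he0.abs).bddAbove_range
  have hEn : ∀ n, |S n - A| ≤ E := fun n => hE ⟨n, rfl⟩
  have hE0 : 0 ≤ E := (abs_nonneg _).trans (hEn 0)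
  rw [Metric.tendsto_nhdsWithin_nhds]
  intro ε hε
  obtain ⟨N₁, hN₁⟩ := Metric.tendsto_atTop.mp he0 (ε / 3) (by positivity)
  set N₀ : ℕ := max N₁ 1 with hN₀
  have hN₀1 : 1 ≤ N₀ := le_max_right _ _
  have hsmall : ∀ n, N₀ ≤ n → |S n - A| ≤ ε / 3 := fun n hn => by
    have := hN₁ n ((le_max_left _ _).trans hn)
    rw [dist_zero_right] at this
    exact this.le
  obtain ⟨δ, hδ0, hδ⟩ := Metric.tendsto_nhdsWithin_nhds.mp (hlim N₀ hN₀1) (ε / (3 * (E + 1)))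
    (by positivity)
  refine ⟨δ, hδ0, fun u hu hud => ?_⟩
  have hu0 : 0 < u := hu
  have hψN₀ : |ψ u N₀ - 1| < ε / (3 * (E + 1)) := hδ hu hud
  -- uniform bound for the partial sums beyond `N₀`
  have hbound : ∀ N, N₀ ≤ N →
      |∑ n ∈ Icc 1 N, c n * ψ u n - A| ≤ ε / 3 + E * (ε / (3 * (E + 1))) := by
    intro N hN
    have hN1 : 1 ≤ N := hN₀1.trans hN
    have hle1 : ∀ n, 1 ≤ n → ψ u n ≤ 1 := fun n hn => kernel_le_one (hψ1 u) (hanti u hu0) hn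
    have hdn : ∀ n, 1 ≤ n → 0 ≤ ψ u n - ψ u (n + 1) := fun n hn => sub_nonneg.mpr (hanti u hu0 n hn)
    rw [sum_mul_kernel_sub_eq c (hψ1 u) A hN1, ← sum_Ico_consecutive _ hN₀1 hN]
    have h1 : |(S N - A) * ψ u N| ≤ ε / 3 * ψ u N := by
      rw [abs_mul, abs_of_nonneg (hpos u hu0 N hN1)]
      exact mul_le_mul_of_nonneg_right (hsmall N hN) (hpos u hu0 N hN1)
    have h2 : |∑ n ∈ Ico 1 N₀, (S n - A) * (ψ u n - ψ u (n + 1))| ≤ E * (ψ u 1 - ψ u N₀) := by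
      refine (abs_sum_le_sum_abs _ _).trans ?_
      rw [← sum_Ico_kernel_sub (ψ u) hN₀1, mul_sum]
      refine sum_le_sum fun n hn => ?_
      have hn1 : 1 ≤ n := (mem_Ico.mp hn).1
      rw [abs_mul, abs_of_nonneg (hdn n hn1)]
      exact mul_le_mul_of_nonneg_right (hEn n) (hdn n hn1)
    have h3 : |∑ n ∈ Ico N₀ N, (S n - A) * (ψ u n - ψ u (n + 1))| ≤ ε / 3 * (ψ u N₀ - ψ u N) := by
      refine (abs_sum_le_sum_abs _ _).trans ?_
      rw [← sum_Ico_kernel_sub (ψ u) hN, mul_sum]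
      refine sum_le_sum fun n hn => ?_
      have hn0 : N₀ ≤ n := (mem_Ico.mp hn).1
      have hn1 : 1 ≤ n := hN₀1.trans hn0
      rw [abs_mul, abs_of_nonneg (hdn n hn1)]
      exact mul_le_mul_of_nonneg_right (hsmall n hn0) (hdn n hn1)
    have hψ1u : ψ u 1 = 1 := hψ1 u
    have hN₀le : ψ u N₀ ≤ 1 := hle1 N₀ hN₀1
    have hlt : 1 - ψ u N₀ ≤ ε / (3 * (E + 1)) := by
      have := (abs_sub_lt_iff.mp hψN₀).2
      linarith
    calc |(S N - A) * ψ u N + (∑ n ∈ Ico 1 N₀, (S n - A) * (ψ u n - ψ u (n + 1))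
            + ∑ n ∈ Ico N₀ N, (S n - A) * (ψ u n - ψ u (n + 1)))|
        ≤ |(S N - A) * ψ u N| + (|∑ n ∈ Ico 1 N₀, (S n - A) * (ψ u n - ψ u (n + 1))|
            + |∑ n ∈ Ico N₀ N, (S n - A) * (ψ u n - ψ u (n + 1))|) :=
          (abs_add_le _ _).trans (add_le_add le_rfl (abs_add_le _ _))
      _ ≤ ε / 3 * ψ u N + (E * (ψ u 1 - ψ u N₀) + ε / 3 * (ψ u N₀ - ψ u N)) :=
          add_le_add h1 (add_le_add h2 h3)
      _ = ε / 3 * ψ u N₀ + E * (1 - ψ u N₀) := by rw [hψ1u]; ring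
      _ ≤ ε / 3 * 1 + E * (ε / (3 * (E + 1))) :=
          add_le_add (mul_le_mul_of_nonneg_left hN₀le (by positivity))
            (mul_le_mul_of_nonneg_left hlt hE0)
      _ = ε / 3 + E * (ε / (3 * (E + 1))) := by ring
  -- pass to the limit `N → ∞`
  have hlimabs : Tendsto (fun N : ℕ => |∑ n ∈ Icc 1 N, c n * ψ u n - A|) atTop (𝓝 |W u - A|) :=
    ((hW u hu0).sub_const A).abs
  have hWle : |W u - A| ≤ ε / 3 + E * (ε / (3 * (E + 1))) :=
    le_of_tendsto hlimabs (eventually_atTop.mpr ⟨N₀, hbound⟩)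
  rw [Real.dist_eq]
  have hE1 : E * (ε / (3 * (E + 1))) < ε / 3 := by
    rw [show E * (ε / (3 * (E + 1))) = ε / 3 * (E / (E + 1)) by field_simp]
    have : E / (E + 1) < 1 := by rw [div_lt_one (by positivity)]; linarith
    calc ε / 3 * (E / (E + 1)) < ε / 3 * 1 := mul_lt_mul_of_pos_left this (by positivity)
      _ = ε / 3 := mul_one _
  linarith

/-! ### The finite-difference kernel `Φ_k(v) = e^{-v} ((1 - e^{-v})/v)ᵏ` -/

/-- The chord slope of the concave function `1 - e^{-v}` from the origin is antitone:
`(1 - e^{-w})/w ≤ (1 - e^{-v})/v` for `0 < v ≤ w`. -/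
theorem one_sub_exp_neg_div_antitone {v w : ℝ} (hv : 0 < v) (hvw : v ≤ w) :
    (1 - exp (-w)) / w ≤ (1 - exp (-v)) / v := by
  have hw : 0 < w := hv.trans_le hvw
  set t : ℝ := v / w with ht
  have ht0 : 0 ≤ t := by positivity
  have ht1 : t ≤ 1 := (div_le_one hw).mpr hvw
  have hconv := convexOn_exp.2 (Set.mem_univ (0 : ℝ)) (Set.mem_univ (-w)) (sub_nonneg.mpr ht1) ht0
    (by ring)
  simp only [smul_eq_mul, mul_zero, zero_add, Real.exp_zero, mul_one] at hconv
  have htw : t * -w = -v := by rw [ht]; field_simp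
  rw [htw] at hconv
  -- `exp(-v) ≤ 1 - t + t exp(-w)`, i.e. `t (1 - exp(-w)) ≤ 1 - exp(-v)`
  rw [div_le_div_iff₀ hw hv]
  have : t * (1 - exp (-w)) ≤ 1 - exp (-v) := by linarith
  calc (1 - exp (-w)) * v = t * (1 - exp (-w)) * w := by rw [ht]; field_simp
    _ ≤ (1 - exp (-v)) * w := by nlinarith

/-- `0 ≤ (1 - e^{-v})/v ≤ 1` for `v > 0`. -/
theorem one_sub_exp_neg_div_mem {v : ℝ} (hv : 0 < v) :
    0 ≤ (1 - exp (-v)) / v ∧ (1 - exp (-v)) / v ≤ 1 := by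
  have h1 : exp (-v) ≤ 1 := exp_le_one_iff.mpr (by linarith)
  have h2 : 1 - exp (-v) ≤ v := by linarith [add_one_le_exp (-v)]
  exact ⟨div_nonneg (by linarith) hv.le, (div_le_one hv).mpr h2⟩

/-- `Φ_k` is antitone on `(0, ∞)`. -/
theorem expKernel_antitone (k : ℕ) {v w : ℝ} (hv : 0 < v) (hvw : v ≤ w) :
    exp (-w) * ((1 - exp (-w)) / w) ^ k ≤ exp (-v) * ((1 - exp (-v)) / v) ^ k := by
  have hw : 0 < w := hv.trans_le hvw
  refine mul_le_mul (exp_le_exp.mpr (by linarith)) (pow_le_pow_left₀ (one_sub_exp_neg_div_mem hw).1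
    (one_sub_exp_neg_div_antitone hv hvw) k) (pow_nonneg (one_sub_exp_neg_div_mem hw).1 k)
    (exp_pos _).le

/-- `0 ≤ Φ_k(v) ≤ 1` for `v > 0`. -/
theorem expKernel_mem {k : ℕ} {v : ℝ} (hv : 0 < v) :
    0 ≤ exp (-v) * ((1 - exp (-v)) / v) ^ k ∧ exp (-v) * ((1 - exp (-v)) / v) ^ k ≤ 1 := by
  obtain ⟨h0, h1⟩ := one_sub_exp_neg_div_mem hv
  refine ⟨mul_nonneg (exp_pos _).le (pow_nonneg h0 k), ?_⟩
  calc exp (-v) * ((1 - exp (-v)) / v) ^ k ≤ 1 * 1 ^ k :=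
        mul_le_mul (exp_le_one_iff.mpr (by linarith)) (pow_le_pow_left₀ h0 h1 k) (pow_nonneg h0 k)
          zero_le_one
    _ = 1 := by rw [one_pow, one_mul]

/-- `Φ_k(v) → 1` as `v → 0⁺`. -/
theorem tendsto_expKernel_one (k : ℕ) :
    Tendsto (fun v : ℝ => exp (-v) * ((1 - exp (-v)) / v) ^ k) (𝓝[>] 0) (𝓝 1) := by
  have hexp : Tendsto (fun v : ℝ => exp (-v)) (𝓝[>] 0) (𝓝 1) := by
    have : Tendsto (fun v : ℝ => exp (-v)) (𝓝 0) (𝓝 (exp (-0))) :=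
      (continuous_exp.comp continuous_neg).tendsto 0
    rw [neg_zero, exp_zero] at this
    exact this.mono_left nhdsWithin_le_nhds
  have hder : HasDerivAt (fun v : ℝ => 1 - exp (-v)) 1 0 := by
    have h := ((Real.hasDerivAt_exp (-0)).comp 0 (hasDerivAt_neg 0)).const_sub 1
    simpa using h
  have hslope : Tendsto (fun v : ℝ => (1 - exp (-v)) / v) (𝓝[>] 0) (𝓝 1) := by
    have h := hasDerivAt_iff_tendsto_slope_zero.mp hder
    simp only [zero_add, neg_zero, exp_zero, sub_self, sub_zero, smul_eq_mul] at h
    refine (h.mono_left (nhdsWithin_mono _ fun x hx => ne_of_gt hx)).congr' ?_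
    filter_upwards [self_mem_nhdsWithin] with v hv
    rw [div_eq_inv_mul]
  have := hexp.mul (hslope.pow k)
  simpa using this

/-! ### The identification lemma -/

/-- `∑_{i=0}^{k} (-1)^{k-i} (k choose i) (i+1)ᵏ = k!` (the `k`-th forward difference of `xᵏ`). -/
theorem sum_neg_one_pow_mul_choose_mul_succ_pow (k : ℕ) :
    ∑ i ∈ range (k + 1), (-1 : ℝ) ^ (k - i) * (k.choose i : ℝ) * ((i : ℝ) + 1) ^ k = (k ! : ℝ) := by
  have h := congr_fun (fwdDiff_iter_eq_factorial (R := ℝ) (n := k)) 1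
  rw [fwdDiff_iter_eq_sum_shift] at h
  simp only [nsmul_eq_mul, mul_one, zsmul_eq_mul, Int.cast_mul, Int.cast_pow,
    Int.cast_neg, Int.cast_one, Int.cast_natCast, Pi.natCast_apply] at h
  rw [← h]
  refine sum_congr rfl fun i _ => ?_
  ring

/-- The pointwise identity behind the finite difference: for `n ≥ 1`, `u > 0`, `k ≥ 1`,
`c logᵏ n · ω_u(n) · (-u)ᵏ = c n^{-u} (n^{-u} - 1)ᵏ`, where `ω_u(1) = 1` and `ω_u(n) = Φ_k(u log n)`. -/
theorem logPow_mul_expKernel_eq {k : ℕ} (hk : 0 < k) {u : ℝ} (hu : 0 < u) {n : ℕ} (hn : 1 ≤ n) (c : ℝ) :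
    c * Real.log n ^ k *
        (if n ≤ 1 then (1 : ℝ)
          else exp (-(u * Real.log n)) * ((1 - exp (-(u * Real.log n))) / (u * Real.log n)) ^ k)
        * (-u) ^ k
      = c * (n : ℝ) ^ (-u) * ((n : ℝ) ^ (-u) - 1) ^ k := by
  rcases eq_or_lt_of_le hn with h1 | h2
  · subst h1
    simp [zero_pow hk.ne']
  · have hn1 : ¬ n ≤ 1 := by omega
    have hnpos : (0 : ℝ) < n := by exact_mod_cast (by omega : 0 < n)
    have hlog : 0 < Real.log n := Real.log_pos (by exact_mod_cast h2)
    have hv : u * Real.log n ≠ 0 := (mul_pos hu hlog).ne'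
    rw [if_neg hn1]
    have hrpow : (n : ℝ) ^ (-u) = exp (-(u * Real.log n)) := by
      rw [Real.rpow_def_of_pos hnpos]; ring_nf
    rw [hrpow, div_pow, mul_pow, neg_pow u k, show ((exp (-(u * Real.log n)) - 1)) ^ k
      = (-1) ^ k * (1 - exp (-(u * Real.log n))) ^ k by rw [← mul_pow]; ring_nf]
    field_simp

/-- **Identification of the `k`-th log-moment.**  If `∑_{n ≤ N} c(n) logᵏ n → A` (`k ≥ 1`), the Dirichlet
series `D(u) = ∑_n c(n) n^{-u}` converges for every `u > 0`, and `D(u)/uᵏ → C` as `u → 0⁺`, then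
`A = (-1)ᵏ · k! · C`. -/
theorem logPowSum_limit_eq_of_dirichletSeries {c : ℕ → ℝ} {k : ℕ} (hk : 0 < k) {A : ℝ}
    (hA : Tendsto (fun N : ℕ => ∑ n ∈ Icc 1 N, c n * Real.log n ^ k) atTop (𝓝 A))
    {D : ℝ → ℝ}
    (hD : ∀ u : ℝ, 0 < u →
      Tendsto (fun N : ℕ => ∑ n ∈ Icc 1 N, c n * (n : ℝ) ^ (-u)) atTop (𝓝 (D u)))
    {C : ℝ} (hC : Tendsto (fun u : ℝ => D u / u ^ k) (𝓝[>] 0) (𝓝 C)) :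
    A = (-1) ^ k * k ! * C := by
  -- the kernel and the Abel sum
  set ψ : ℝ → ℕ → ℝ := fun u n => if n ≤ 1 then (1 : ℝ)
    else exp (-(u * Real.log n)) * ((1 - exp (-(u * Real.log n))) / (u * Real.log n)) ^ k with hψ
  set W : ℝ → ℝ := fun u =>
    (∑ i ∈ range (k + 1), (-1 : ℝ) ^ (k - i) * (k.choose i : ℝ) * D (((i : ℝ) + 1) * u))
      / (-u) ^ k with hWdef
  have hψ1 : ∀ u, ψ u 1 = 1 := fun u => by simp [hψ]
  have hv : ∀ u : ℝ, 0 < u → ∀ n : ℕ, 2 ≤ n → 0 < u * Real.log n := fun u hu n hn =>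
    mul_pos hu (Real.log_pos (by exact_mod_cast hn))
  have hanti : ∀ u, 0 < u → ∀ n, 1 ≤ n → ψ u (n + 1) ≤ ψ u n := by
    intro u hu n hn
    rcases eq_or_lt_of_le hn with h1 | h2
    · subst h1
      simp only [hψ, le_refl, if_true, show ¬ (1 + 1 : ℕ) ≤ 1 by omega, if_false]
      exact (expKernel_mem (hv u hu 2 le_rfl)).2
    · simp only [hψ, show ¬ n + 1 ≤ 1 by omega, show ¬ n ≤ 1 by omega, if_false]
      refine expKernel_antitone k (hv u hu n h2) (mul_le_mul_of_nonneg_left ?_ hu.le)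
      exact Real.log_le_log (by exact_mod_cast (by omega : 0 < n)) (by exact_mod_cast Nat.le_succ n)
  have hpos : ∀ u, 0 < u → ∀ n, 1 ≤ n → 0 ≤ ψ u n := by
    intro u hu n hn
    rcases eq_or_lt_of_le hn with h1 | h2
    · subst h1; rw [hψ1]; exact zero_le_one
    · simp only [hψ, show ¬ n ≤ 1 by omega, if_false]
      exact (expKernel_mem (hv u hu n h2)).1
  have hlim : ∀ n : ℕ, 1 ≤ n → Tendsto (fun u => ψ u n) (𝓝[>] 0) (𝓝 1) := by
    intro n hn
    rcases eq_or_lt_of_le hn with h1 | h2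
    · subst h1; simp only [hψ1]; exact tendsto_const_nhds
    · simp only [hψ, show ¬ n ≤ 1 by omega, if_false]
      have hlog : 0 < Real.log n := Real.log_pos (by exact_mod_cast h2)
      have hmul : Tendsto (fun u : ℝ => u * Real.log n) (𝓝[>] 0) (𝓝[>] 0) := by
        refine tendsto_nhdsWithin_of_tendsto_nhds_of_eventually_within _ ?_ ?_
        · have : Tendsto (fun u : ℝ => u * Real.log n) (𝓝 0) (𝓝 (0 * Real.log n)) :=
            tendsto_id.mul_const _
          rw [zero_mul] at this
          exact this.mono_left nhdsWithin_le_nhds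
        · filter_upwards [self_mem_nhdsWithin] with u hu
          exact mul_pos hu hlog
      exact (tendsto_expKernel_one k).comp hmul
  -- the Abel sums converge to `W u`
  have hW : ∀ u, 0 < u → Tendsto (fun N : ℕ => ∑ n ∈ Icc 1 N, c n * Real.log n ^ k * ψ u n) atTop
      (𝓝 (W u)) := by
    intro u hu
    have huk : (-u) ^ k ≠ 0 := pow_ne_zero _ (neg_ne_zero.mpr hu.ne')
    have hexp : ∀ N : ℕ, ∑ n ∈ Icc 1 N, c n * Real.log n ^ k * ψ u n
        = (∑ i ∈ range (k + 1), (-1 : ℝ) ^ (k - i) * (k.choose i : ℝ) *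
            ∑ n ∈ Icc 1 N, c n * (n : ℝ) ^ (-(((i : ℝ) + 1) * u))) / (-u) ^ k := by
      intro N
      rw [eq_div_iff huk, sum_mul]
      have hpt : ∀ n ∈ Icc 1 N, c n * Real.log n ^ k * ψ u n * (-u) ^ k
          = ∑ i ∈ range (k + 1), (-1 : ℝ) ^ (k - i) * (k.choose i : ℝ) *
              (c n * (n : ℝ) ^ (-(((i : ℝ) + 1) * u))) := by
        intro n hn
        have hn1 : 1 ≤ n := (mem_Icc.mp hn).1
        have hn0 : (0 : ℝ) ≤ n := Nat.cast_nonneg n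
        rw [show c n * Real.log n ^ k * ψ u n * (-u) ^ k
            = c n * (n : ℝ) ^ (-u) * ((n : ℝ) ^ (-u) - 1) ^ k from logPow_mul_expKernel_eq hk hu hn1 (c n),
          sub_eq_add_neg, add_pow, mul_sum]
        refine sum_congr rfl fun i hi => ?_
        have hpow : ((n : ℝ) ^ (-u)) ^ i * (n : ℝ) ^ (-u) = (n : ℝ) ^ (-(((i : ℝ) + 1) * u)) := by
          rw [← pow_succ, ← Real.rpow_mul_natCast hn0]
          congr 1; push_cast; ring
        calc c n * (n : ℝ) ^ (-u) * (((n : ℝ) ^ (-u)) ^ i * (-1) ^ (k - i) * (k.choose i : ℝ))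
            = (-1) ^ (k - i) * (k.choose i : ℝ) * (c n * (((n : ℝ) ^ (-u)) ^ i * (n : ℝ) ^ (-u))) := by
              ring
          _ = (-1) ^ (k - i) * (k.choose i : ℝ) * (c n * (n : ℝ) ^ (-(((i : ℝ) + 1) * u))) := by
              rw [hpow]
      rw [sum_congr rfl hpt, sum_comm]
      exact sum_congr rfl fun i _ => by rw [mul_sum]
    simp_rw [hexp]
    refine Tendsto.div_const (tendsto_finsetSum _ fun i _ => ?_) _
    exact (hD _ (by positivity)).const_mul _
  -- Abel: `W u → A`
  have hWA : Tendsto W (𝓝[>] 0) (𝓝 A) := tendsto_of_antitone_weights hA hψ1 hanti hpos hlim hW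
  -- from `D(u) ~ C u^k`: `W u → (-1)^k k! C`
  have hWC : Tendsto W (𝓝[>] 0) (𝓝 ((-1) ^ k * k ! * C)) := by
    have hscale : ∀ i : ℕ, Tendsto (fun u : ℝ => D (((i : ℝ) + 1) * u) / u ^ k) (𝓝[>] 0)
        (𝓝 (((i : ℝ) + 1) ^ k * C)) := by
      intro i
      have hi : (0 : ℝ) < (i : ℝ) + 1 := by positivity
      have hmul : Tendsto (fun u : ℝ => ((i : ℝ) + 1) * u) (𝓝[>] 0) (𝓝[>] 0) := by
        refine tendsto_nhdsWithin_of_tendsto_nhds_of_eventually_within _ ?_ ?_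
        · have : Tendsto (fun u : ℝ => ((i : ℝ) + 1) * u) (𝓝 0) (𝓝 (((i : ℝ) + 1) * 0)) :=
            tendsto_id.const_mul _
          rw [mul_zero] at this
          exact this.mono_left nhdsWithin_le_nhds
        · filter_upwards [self_mem_nhdsWithin] with u hu
          exact mul_pos hi hu
      have h := (hC.comp hmul).const_mul (((i : ℝ) + 1) ^ k)
      refine h.congr' ?_
      filter_upwards [self_mem_nhdsWithin] with u hu
      have hu0 : (u : ℝ) ≠ 0 := ne_of_gt hu
      simp only [Function.comp_def]
      rw [mul_pow]
      field_simp
    have hsum : Tendsto (fun u : ℝ => ∑ i ∈ range (k + 1),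
        (-1 : ℝ) ^ (k - i) * (k.choose i : ℝ) * (D (((i : ℝ) + 1) * u) / u ^ k)) (𝓝[>] 0)
        (𝓝 (∑ i ∈ range (k + 1), (-1 : ℝ) ^ (k - i) * (k.choose i : ℝ) * (((i : ℝ) + 1) ^ k * C))) :=
      tendsto_finsetSum _ fun i _ => (hscale i).const_mul _
    have hval : ∑ i ∈ range (k + 1), (-1 : ℝ) ^ (k - i) * (k.choose i : ℝ) * (((i : ℝ) + 1) ^ k * C)
        = k ! * C := by
      rw [← sum_neg_one_pow_mul_choose_mul_succ_pow k, sum_mul]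
      exact sum_congr rfl fun i _ => by ring
    rw [hval] at hsum
    have h := hsum.const_mul ((-1 : ℝ) ^ k)
    rw [← mul_assoc] at h
    refine h.congr' ?_
    filter_upwards [self_mem_nhdsWithin] with u hu
    have hu0 : (u : ℝ) ≠ 0 := ne_of_gt hu
    rw [hWdef]
    simp only
    rw [neg_pow u, mul_sum, sum_div]
    refine sum_congr rfl fun i _ => ?_
    have h1 : ((-1 : ℝ) ^ k)⁻¹ = (-1) ^ k := by
      rw [← inv_pow, inv_neg, inv_one]
    rw [mul_comm ((-1 : ℝ) ^ k) (u ^ k), ← div_div, div_eq_mul_inv _ ((-1 : ℝ) ^ k), h1]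
    ring
  exact tendsto_nhds_unique hWA hWC

end Summit.Parity.BatemanHorn.Theorems
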